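import Literature.AlgebraicGeometry.PlaneCurves.HessePencilWeierstrassForm
import Literature.AlgebraicGeometry.PlaneCurves.PlaneCubicJInvariant
import HarnessLib

/-!
# The Hesse canonical form of a smooth plane cubic (Artebani–Dolgachev, Lemma 1)

Topic `Literature/AlgebraicGeometry/PlaneCurves`, namespace `Literature.AlgebraicGeometry.PlaneCurves`.
Lane `lit-hodgefound`, seat `lit-hodgefound-p37`, row g17-#7; a one-file sequel of the seat's
`HessePencilWeierstrassForm` (g16-#4: `H_μ ∘ M_μ = (μ³ − 1) · W_μ`, `W_μ` elliptic iff `μ³ ≠ 1`,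
`j(W_μ) = 27μ³(μ³ + 8)³/(μ³ − 1)³`, whose docstring listed "Lemma 1 itself" as NOT there),
`PlaneCubicJInvariant` (g17-#2: two elliptic Weierstrass cubics over a separably closed field are
projectively equivalent iff their `j`-invariants agree) and `WeierstrassNormalForm` (Q1762: every
non-singular ternary cubic has an elliptic Weierstrass model).  Everything here is PROVED; no
definition, no named fact.

Source followed — M. Artebani, I. Dolgachev, *The Hesse pencil of plane cubic curves*,
L'Enseignement Math. (2) 55 (2009) 235–273, §2 [arXiv:math/0611590, held `paper:arxiv-math_0611590`
p0004 L3, L48–L76; p0005 L1–L16]: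

> Let `k` be an algebraically closed field of characteristic different from `3` […]
> **Lemma 1.** Any smooth plane cubic is projectively equivalent to a member of the Hesse pencil,
> i.e. it admits a Hesse canonical form: `x³ + y³ + z³ + λxyz = 0`.
> *Proof.* We will follow the arguments from [W]. Let `E` be a nonsingular plane cubic. Given two
> inflection tangent lines for `E` we can choose projective coordinates such that their equations
> are `x = 0` and `y = 0`. […] Let `ε` be a primitive 3rd root of unity and define new coordinates
> […] we get a Hesse equation for `E`. □
> […] The discriminant […] `Δ = 4A³ + 27B² = 2²3³u₀³(u₀³ + 8u₁³)³`, its zeroes describe the singular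
> members of the pencil. […] The map `j : ℙ¹ → ℙ¹`, `(t₀, t₁) ↦ (4A³, 4A³ + 27B²)` coincides (up to
> a scalar factor) with the map assigning to the elliptic curve `E_λ` its `j`-invariant, which
> distinguishes the projective equivalence classes of cubic curves.

## The road taken (a deviation from the printed proof, using what the tree has)

Artebani–Dolgachev (after Weber) normalise two inflection tangents and extract a cube root of unity.
Here Lemma 1 is obtained from the `j`-INVARIANT instead, in three proved steps:
(1) `exists_hesse_weierstrass_j_eq` — every `a ∈ K = K̄` is `j(W_μ)` for some `μ` with `μ³ ≠ 1`
(a root `t ≠ 1` of the quartic `27t(t + 8)³ − a(t − 1)³`, leading coefficient `27 ≠ 0`, and a cube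
root `μ` of `t`; then `j(W_μ) = 27μ³(μ³ + 8)³/(μ³ − 1)³ = a`) — the surjectivity of the `j`-map of
the pencil; (2) `weierstrass_exists_bind₁_hesse_eq_smul` — hence every elliptic Weierstrass cubic
`W` is projectively equivalent to some smooth `H_μ` (`j(W_μ) = j(W)`, g17-#2, composed with
`H_μ ∘ M_μ = (μ³ − 1) · W_μ`); (3) **`exists_bind₁_eq_smul_hesse_of_forall_regular` = Lemma 1**:
every ternary cubic form all of whose points are regular is carried by an invertible linear
substitution to `c · H_μ`, `μ³ ≠ 1`, `c ≠ 0` (its elliptic Weierstrass model, Q1762, then (2)).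
Finally `hesse_exists_bind₁_eq_smul_iff` — "which distinguishes the projective equivalence
classes": two smooth members `H_μ`, `H_ν` are projectively equivalent iff
`μ³(μ³ + 8)³/(μ³ − 1)³ = ν³(ν³ + 8)³/(ν³ − 1)³`.

## Dictionary

* The pencil member `t₀(x³ + y³ + z³) + t₁xyz` is written `H_μ = X³ + Y³ + Z³ − 3μXYZ`
  (`(t₀, t₁) = (1, −3μ)`), exactly as in `HessePencilWeierstrassForm` and the Mumford files; its
  Weierstrass model is `W_μ = ⟨−μ, −μ², (μ³−1)/3, μ(μ³−1)/3, −(μ³−1)²/27⟩` and the substitution is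
  `M_μ = [[−μ, 1, (μ³−1)/3], [0, −1, 0], [1, 0, 0]]` (local notations `𝐇[μ]`, `𝐖[μ]`, `𝐌[μ]`, no
  definitions).
* "projectively equivalent": `bind₁ M.toMvPolynomial F = c • G` with `det M ≠ 0`, `c ≠ 0`
  (`F ∘ M = c · G`), as everywhere in the lane.
* "smooth plane cubic": a ternary cubic form `F` with `∇F(p) ≠ 0` at every point `p ≠ 0` of
  `{F = 0}` over `K̄`.

Hypotheses, compared with the source: Artebani–Dolgachev have `k = k̄` of characteristic `≠ 3`;
here (1), (2) and the `iff` need `3 ≠ 0` (and `K̄`, resp. `K` separably closed for the `iff`),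
while Lemma 1 for a general form `F` is proved under `2 ≠ 0` AND `3 ≠ 0` — the extra `2 ≠ 0`
comes from the tree's flex-existence theorem behind the Weierstrass model
(`WeierstrassNormalForm.exists_weierstrass_isElliptic_of_forall_regular`), not from the argument.
NOT here: Weber's coordinate proof (two inflection tangents, `ε`), the singular members, the
`3`-level structure, `S(3)`, the group `G₂₁₆`.

## References
* [ArtebaniDolgachev2009] M. Artebani, I. Dolgachev, *The Hesse pencil of plane cubic curves*,
  Enseign. Math. (2) 55 (2009) 235–273, §2, Lemma 1 and the `j`-map of the pencil.
* [Knapp1992] A. W. Knapp, *Elliptic Curves*, Princeton 1992, §II.2 (`F^Φ = F ∘ Φ⁻¹`), §II.4,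
  Prop. 2.14.
-/

set_option autoImplicit false

open MvPolynomial Matrix
open Literature.AlgebraicGeometry.HyperbolicPolynomials

namespace Literature.AlgebraicGeometry.PlaneCurves

universe u

/-- The Hesse cubic `H_μ = X³ + Y³ + Z³ − 3μXYZ` (local notation as in the statements of
`HessePencilWeierstrassForm`, no definition). -/
local notation3 "𝐇[" μ "]" =>
  (X 0 ^ 3 + X 1 ^ 3 + X 2 ^ 3 - C (3 * μ) * (X 0 * X 1 * X 2) : MvPolynomial (Fin 3) _)

/-- The Weierstrass model `W_μ = ⟨−μ, −μ², (μ³−1)/3, μ(μ³−1)/3, −(μ³−1)²/27⟩` of `H_μ`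
(`HessePencilWeierstrassForm`; local notation, no definition). -/
local notation3 "𝐖[" μ "]" =>
  ({ a₁ := -μ, a₂ := -μ ^ 2, a₃ := (μ ^ 3 - 1) / 3, a₄ := μ * (μ ^ 3 - 1) / 3,
     a₆ := -(μ ^ 3 - 1) ^ 2 / 27 } : WeierstrassCurve _)

/-- The substitution `M_μ` with `H_μ ∘ M_μ = (μ³ − 1) · W_μ`
(`HessePencilWeierstrassForm.hesse_bind₁_eq_smul_weierstrass`; local notation, no definition). -/
local notation3 "𝐌[" μ "]" =>
  (Matrix.of ![![-μ, 1, (μ ^ 3 - 1) / 3], ![0, -1, 0], ![1, 0, 0]] : Matrix (Fin 3) (Fin 3) _)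

section HesseCanonicalForm

variable {K : Type u} [Field K]

/-- The identity substitution `F ∘ 1 = F`. [cite: Knapp1992, §II.2 (`F^Φ = F ∘ Φ⁻¹`)] -/
private theorem bind₁_toMvPolynomial_one' (P : MvPolynomial (Fin 3) K) :
    bind₁ (1 : Matrix (Fin 3) (Fin 3) K).toMvPolynomial P = P := by
  rw [Matrix.toMvPolynomial_one, bind₁_X_left, AlgHom.id_apply]

/-- Inverting a substitution: from `P ∘ M = c·Q` to `Q ∘ M⁻¹ = c⁻¹·P`.
[cite: Knapp1992, §II.2 (`F^Φ = F ∘ Φ⁻¹`)] -/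
private theorem bind₁_inv_of_bind₁_eq_smul' {M : Matrix (Fin 3) (Fin 3) K} (hM : M.det ≠ 0)
    {P Q : MvPolynomial (Fin 3) K} {c : K} (hc : c ≠ 0)
    (h : bind₁ M.toMvPolynomial P = c • Q) :
    bind₁ M⁻¹.toMvPolynomial Q = c⁻¹ • P := by
  have h1 : bind₁ M⁻¹.toMvPolynomial (bind₁ M.toMvPolynomial P) = P := by
    rw [← bind₁_toMvPolynomial_mul, Matrix.mul_nonsing_inv M (isUnit_iff_ne_zero.2 hM),
      bind₁_toMvPolynomial_one']
  rw [h, map_smul] at h1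
  rw [← h1, smul_smul, inv_mul_cancel₀ hc, one_smul]

/-! ## §1 Every `j` is attained by a smooth member of the Hesse pencil -/

/-- **The `j`-map of the Hesse pencil is onto** ("The map `j : ℙ¹ → ℙ¹` … coincides (up to a
scalar factor) with the map assigning to the elliptic curve `E_λ` its `j`-invariant"): over an
algebraically closed field with `3 ≠ 0`, every `a ∈ K` is the `j`-invariant of the (elliptic)
Weierstrass model `W_μ` of a smooth member `H_μ`, `μ³ ≠ 1`, of the pencil.  Proof: the quartic
`27t(t + 8)³ − a(t − 1)³` (leading coefficient `27 ≠ 0`) has a root `t`, necessarily `≠ 1`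
(its value at `1` is `3⁹`); take a cube root `μ` of `t` and use
`j(W_μ) = 27μ³(μ³ + 8)³/(μ³ − 1)³` (`hesse_weierstrass_j`).
[cite: ArtebaniDolgachev2009, §2 (the `j`-map of the Hesse pencil)] -/
theorem exists_hesse_weierstrass_j_eq [IsAlgClosed K] (h3 : (3 : K) ≠ 0) (a : K) :
    ∃ (μ : K) (_ : (𝐖[μ] : WeierstrassCurve K).IsElliptic),
      μ ^ 3 ≠ 1 ∧ (𝐖[μ] : WeierstrassCurve K).j = a := by
  have h27 : (27 : K) ≠ 0 := by
    rw [show (27 : K) = 3 ^ 3 by norm_num]; exact pow_ne_zero 3 h3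
  -- the quartic `g(t) = 27 t (t + 8)³ − a (t − 1)³` in `t = μ³`
  set p : Polynomial K := Polynomial.C 27 * Polynomial.X * (Polynomial.X + Polynomial.C 8) ^ 3
    with hp
  set q : Polynomial K := Polynomial.C a * (Polynomial.X - Polynomial.C 1) ^ 3 with hq
  have hp4 : p.natDegree = 4 := by
    rw [hp, Polynomial.natDegree_mul (mul_ne_zero (Polynomial.C_ne_zero.2 h27) Polynomial.X_ne_zero)
      (pow_ne_zero 3 (Polynomial.X_add_C_ne_zero 8)), Polynomial.natDegree_C_mul_X 27 h27,
      Polynomial.natDegree_pow, Polynomial.natDegree_X_add_C]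
  have hq3 : q.natDegree ≤ 3 := by
    rw [hq]
    refine (Polynomial.natDegree_C_mul_le a _).trans ?_
    rw [Polynomial.natDegree_pow, Polynomial.natDegree_X_sub_C]
  have h4 : (p - q).natDegree = 4 := by
    rw [Polynomial.natDegree_sub_eq_left_of_natDegree_lt (lt_of_le_of_lt hq3 (by rw [hp4]; norm_num)),
      hp4]
  have hdeg : (p - q).degree ≠ 0 := fun h0 => by
    have h00 := Polynomial.natDegree_eq_zero_iff_degree_le_zero.2 h0.le
    rw [h4] at h00
    exact absurd h00 (by norm_num)
  obtain ⟨t, ht⟩ := IsAlgClosed.exists_root (p - q) hdeg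
  have ht' : 27 * t * (t + 8) ^ 3 - a * (t - 1) ^ 3 = 0 := by
    have := ht.eq_zero
    simpa [hp, hq] using this
  have ht1 : t ≠ 1 := by
    rintro rfl
    apply pow_ne_zero 9 h3
    linear_combination ht'
  -- a cube root `μ` of `t`
  obtain ⟨μ, hμ⟩ := IsAlgClosed.exists_root (Polynomial.X ^ 3 - Polynomial.C t)
    (by rw [Polynomial.degree_X_pow_sub_C (by norm_num) t]; norm_num)
  have hμt : μ ^ 3 = t := by
    have := hμ.eq_zero
    simp only [Polynomial.eval_sub, Polynomial.eval_pow, Polynomial.eval_X, Polynomial.eval_C] at this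
    exact sub_eq_zero.1 this
  have hμ1 : μ ^ 3 ≠ 1 := by rw [hμt]; exact ht1
  haveI hE := (hesse_weierstrass_isElliptic_iff h3 μ).2 hμ1
  refine ⟨μ, hE, hμ1, ?_⟩
  rw [hesse_weierstrass_j h3 hμ1, hμt, div_eq_iff (pow_ne_zero 3 (sub_ne_zero.2 ht1))]
  linear_combination ht'

/-! ## §2 Lemma 1: every smooth cubic has a Hesse canonical form -/

/-- **Every elliptic Weierstrass cubic is projectively equivalent to a smooth member of the Hesse
pencil**: over `K = K̄` with `3 ≠ 0`, for an elliptic `W` there are `μ` with `μ³ ≠ 1`, an invertible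
`M` and `c ≠ 0` with `H_μ ∘ M = c · W` — namely `M = M_μ M₁`, where `j(W_μ) = j(W)`
(`exists_hesse_weierstrass_j_eq`) gives `W_μ ∘ M₁ = c₁ · W`
(`PlaneCubicJInvariant.weierstrass_exists_bind₁_eq_smul_iff_j_eq`) and `H_μ ∘ M_μ = (μ³ − 1) · W_μ`
(`hesse_bind₁_eq_smul_weierstrass`). [cite: ArtebaniDolgachev2009, §2, Lemma 1] -/
theorem weierstrass_exists_bind₁_hesse_eq_smul [IsAlgClosed K] (h3 : (3 : K) ≠ 0)
    (W : WeierstrassCurve K) [W.IsElliptic] :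
    ∃ (μ : K) (M : Matrix (Fin 3) (Fin 3) K) (c : K), μ ^ 3 ≠ 1 ∧ M.det ≠ 0 ∧ c ≠ 0 ∧
      bind₁ M.toMvPolynomial 𝐇[μ] = c • W.toProjective.polynomial := by
  obtain ⟨μ, hE, hμ, hj⟩ := exists_hesse_weierstrass_j_eq h3 W.j
  obtain ⟨M₁, c₁, hM₁, hc₁, h₁⟩ :=
    (weierstrass_exists_bind₁_eq_smul_iff_j_eq (W := 𝐖[μ]) (W' := W)).2 hj
  refine ⟨μ, 𝐌[μ] * M₁, (μ ^ 3 - 1) * c₁, hμ, ?_, mul_ne_zero (sub_ne_zero.2 hμ) hc₁, ?_⟩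
  · rw [Matrix.det_mul, hesse_matrix_det]
    exact mul_ne_zero (div_ne_zero (sub_ne_zero.2 hμ) h3) hM₁
  · rw [bind₁_toMvPolynomial_mul, hesse_bind₁_eq_smul_weierstrass h3 μ, map_smul, h₁, smul_smul]

/-- **Artebani–Dolgachev, Lemma 1: "Any smooth plane cubic is projectively equivalent to a member
of the Hesse pencil, i.e. it admits a Hesse canonical form `x³ + y³ + z³ + λxyz = 0`."**  Over an
algebraically closed field with `2 ≠ 0` and `3 ≠ 0`: a ternary cubic form `F` all of whose points
are regular is carried by an invertible linear substitution `M` to `c · H_μ = c · (X³ + Y³ + Z³ −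
3μXYZ)` with `c ≠ 0` and `μ³ ≠ 1` (a SMOOTH member).  Proof (by the `j`-invariant, see the module
docstring; the source normalises two inflection tangents instead): `F ∘ M₁ = c₁ · E` for an
elliptic Weierstrass `E` (`WeierstrassNormalForm.exists_weierstrass_isElliptic_of_forall_regular`,
where `2 ≠ 0` is used), `H_μ ∘ M₂ = c₂ · E` (`weierstrass_exists_bind₁_hesse_eq_smul`), hence
`F ∘ (M₁M₂⁻¹) = c₁c₂⁻¹ · H_μ`. [cite: ArtebaniDolgachev2009, §2, Lemma 1] -/
theorem exists_bind₁_eq_smul_hesse_of_forall_regular [IsAlgClosed K] (h2 : (2 : K) ≠ 0)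
    (h3 : (3 : K) ≠ 0) {F : MvPolynomial (Fin 3) K} (hF : F.IsHomogeneous 3)
    (hreg : ∀ p : Fin 3 → K, p ≠ 0 → eval p F = 0 → (fun i => eval p (pderiv i F)) ≠ 0) :
    ∃ (μ : K) (M : Matrix (Fin 3) (Fin 3) K) (c : K), μ ^ 3 ≠ 1 ∧ M.det ≠ 0 ∧ c ≠ 0 ∧
      bind₁ M.toMvPolynomial F = c • 𝐇[μ] := by
  obtain ⟨M₁, E, c₁, hM₁, hc₁, hE, hF₁, -⟩ := exists_weierstrass_isElliptic_of_forall_regular h2 hF hreg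
  haveI := hE
  obtain ⟨μ, M₂, c₂, hμ, hM₂, hc₂, h₂⟩ := weierstrass_exists_bind₁_hesse_eq_smul h3 E
  have h₂' := bind₁_inv_of_bind₁_eq_smul' hM₂ hc₂ h₂
  refine ⟨μ, M₁ * M₂⁻¹, c₁ * c₂⁻¹, hμ, ?_, mul_ne_zero hc₁ (inv_ne_zero hc₂), ?_⟩
  · rw [Matrix.det_mul]
    exact mul_ne_zero hM₁ (Matrix.isUnit_nonsing_inv_det M₂ (isUnit_iff_ne_zero.2 hM₂)).ne_zero
  · rw [bind₁_toMvPolynomial_mul, hF₁, map_smul, h₂', smul_smul]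

/-! ## §3 Two smooth members of the pencil are projectively equivalent iff their `j` agree -/

/-- **The `j`-map "distinguishes the projective equivalence classes of cubic curves"**: over a
separably closed field with `3 ≠ 0`, two smooth members `H_μ`, `H_ν` (`μ³, ν³ ≠ 1`) of the Hesse
pencil are projectively equivalent — `H_μ ∘ M = c · H_ν` for some invertible `M` and `c ≠ 0` — if
and only if `μ³(μ³ + 8)³/(μ³ − 1)³ = ν³(ν³ + 8)³/(ν³ − 1)³` (i.e. `j(W_μ) = j(W_ν)`): transport
along `H ∘ M = (·³ − 1) · W` both ways and `PlaneCubicJInvariant.weierstrass_exists_bind₁_eq_smul_iff_j_eq`.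
[cite: ArtebaniDolgachev2009, §2 (the `j`-map of the Hesse pencil)] -/
theorem hesse_exists_bind₁_eq_smul_iff [IsSepClosed K] (h3 : (3 : K) ≠ 0) {μ ν : K}
    (hμ : μ ^ 3 ≠ 1) (hν : ν ^ 3 ≠ 1) :
    (∃ (M : Matrix (Fin 3) (Fin 3) K) (c : K), M.det ≠ 0 ∧ c ≠ 0 ∧
        bind₁ M.toMvPolynomial 𝐇[μ] = c • 𝐇[ν]) ↔
      μ ^ 3 * (μ ^ 3 + 8) ^ 3 / (μ ^ 3 - 1) ^ 3 = ν ^ 3 * (ν ^ 3 + 8) ^ 3 / (ν ^ 3 - 1) ^ 3 := by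
  haveI hEμ := (hesse_weierstrass_isElliptic_iff h3 μ).2 hμ
  haveI hEν := (hesse_weierstrass_isElliptic_iff h3 ν).2 hν
  have h27 : (27 : K) ≠ 0 := by
    rw [show (27 : K) = 3 ^ 3 by norm_num]; exact pow_ne_zero 3 h3
  -- the `j`-invariants of the Weierstrass models
  have hj : (𝐖[μ] : WeierstrassCurve K).j = (𝐖[ν] : WeierstrassCurve K).j ↔
      μ ^ 3 * (μ ^ 3 + 8) ^ 3 / (μ ^ 3 - 1) ^ 3 = ν ^ 3 * (ν ^ 3 + 8) ^ 3 / (ν ^ 3 - 1) ^ 3 := by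
    rw [hesse_weierstrass_j h3 hμ, hesse_weierstrass_j h3 hν, mul_assoc (27 : K), mul_assoc (27 : K),
      mul_div_assoc (27 : K), mul_div_assoc (27 : K), mul_right_inj' h27]
  rw [← hj, ← weierstrass_exists_bind₁_eq_smul_iff_j_eq (W := 𝐖[μ]) (W' := 𝐖[ν])]
  have hdetμ : (𝐌[μ] : Matrix (Fin 3) (Fin 3) K).det ≠ 0 := by
    rw [hesse_matrix_det]; exact div_ne_zero (sub_ne_zero.2 hμ) h3
  have hdetν : (𝐌[ν] : Matrix (Fin 3) (Fin 3) K).det ≠ 0 := by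
    rw [hesse_matrix_det]; exact div_ne_zero (sub_ne_zero.2 hν) h3
  have hWμ := hesse_bind₁_eq_smul_weierstrass h3 μ
  have hWν := hesse_bind₁_eq_smul_weierstrass h3 ν
  constructor
  · rintro ⟨M, c, hM, hc, h⟩
    -- `W_μ ∘ (M_μ⁻¹ M M_ν) ∝ W_ν`
    have hinv := bind₁_inv_of_bind₁_eq_smul' hdetμ (sub_ne_zero.2 hμ) hWμ
    refine ⟨(𝐌[μ])⁻¹ * M * 𝐌[ν], (μ ^ 3 - 1)⁻¹ * c * (ν ^ 3 - 1), ?_, ?_, ?_⟩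
    · rw [Matrix.det_mul, Matrix.det_mul]
      exact mul_ne_zero (mul_ne_zero
        (Matrix.isUnit_nonsing_inv_det _ (isUnit_iff_ne_zero.2 hdetμ)).ne_zero hM) hdetν
    · exact mul_ne_zero (mul_ne_zero (inv_ne_zero (sub_ne_zero.2 hμ)) hc) (sub_ne_zero.2 hν)
    · rw [bind₁_toMvPolynomial_mul, bind₁_toMvPolynomial_mul, hinv, map_smul, h, map_smul, map_smul,
        hWν, smul_smul, smul_smul]
  · rintro ⟨A, c, hA, hc, h⟩
    -- `H_μ ∘ (M_μ A M_ν⁻¹) ∝ H_ν`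
    have hinv := bind₁_inv_of_bind₁_eq_smul' hdetν (sub_ne_zero.2 hν) hWν
    refine ⟨𝐌[μ] * A * (𝐌[ν])⁻¹, (μ ^ 3 - 1) * c * (ν ^ 3 - 1)⁻¹, ?_, ?_, ?_⟩
    · rw [Matrix.det_mul, Matrix.det_mul]
      exact mul_ne_zero (mul_ne_zero hdetμ hA)
        (Matrix.isUnit_nonsing_inv_det _ (isUnit_iff_ne_zero.2 hdetν)).ne_zero
    · exact mul_ne_zero (mul_ne_zero (sub_ne_zero.2 hμ) hc) (inv_ne_zero (sub_ne_zero.2 hν))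
    · rw [bind₁_toMvPolynomial_mul, bind₁_toMvPolynomial_mul, hWμ, map_smul, h, map_smul, map_smul,
        hinv, smul_smul, smul_smul]

end HesseCanonicalForm

end Literature.AlgebraicGeometry.PlaneCurves
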